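import Summits.Ventures.CertifiedArithmetic.LowPrec.OptTreeRZ
import Literature.ComputerArithmetic.JeannerodRump2013.InnerProduct

/-!
HONEST FRAMING: certified error envelopes and provably optimal rounding/accumulation schemes for
low-precision formats under stated cost models; every table by two implementations; no hardware
or vendor claims.

# Theorem T7 (c)–(e): the round-toward-zero witness, the sequential law, pairwise optimality

Continuation of `OptTreeRZ.lean` (cost model CM-T, objective T-poly, round-toward-zero = round-down
on nonnegative data, `u = 2^-p`, `v = rzUnit p = 2u - 2u²`).

* `truncation_bound_attained`: T7(a) is sharp (`2^E + v·2^E ↦ 2^E`).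
* `witRZ u S t` (T7(c)): the relabelling of `t` with spine leaf `S` and, behind `λ ≥ 1` light edges,
  the leaf `(2-2u)·S·u^λ`; `exact = S·N_t(u)` with `treeN u t = 1 + (2-2u)(M_t(u)-1)`, and under
  every round-down map the computed root is `S` (every addition is a full absorption,
  `roundDown_absorb_spine`, `roundDown_absorb_light`), so the relative under-estimation is EXACTLY
  `1 - 1/N_t` (`rz_witness_attains`).  Hence `1 - 1/N_t ≤ W_RZ(t) ≤ 1 - 1/M_t(v)` for every tree.
* T7(d) (`treeN_seqTree`): on the sequential tree the two bounds coincide: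
  `N = M(v) = 1 + (n-1)v`, so `W_RZ(seq_n) = (n-1)v/(1+(n-1)v)` exactly, every `n ≥ 1`, `p ≥ 1`.
* T7(e) (`treeN_pw_le`, with `treeM_pw_le_treeM` at `v`): pairwise summation minimises both bounds.
* `R4_TreeLawRZ` / `R4_TreeLawRZ_holds`: the statement-style conjunction.
The exact worst case of a general tree is a finite optimisation that is NOT `1 - 1/N_t` in general
(certificate C19: all 191 shapes with `n ≤ 10` leaves satisfy it at `p = 2,3,4`, exactly one of the
207 shapes with `n = 11` violates it); see OPTIMA.md §T, Theorem T7.  New results of this cell.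
-/

namespace Summit.Ventures.CertifiedArithmetic.LowPrec.Opt

open Literature.ComputerArithmetic.JeannerodRump2018
open Literature.ComputerArithmetic.JeannerodRump2018.SumTree
open Literature.ComputerArithmetic.LangeRump2018 (isFloat_zpow)
open Literature.ComputerArithmetic.JeannerodRump2013 (unitRoundoff_pos)

variable {p : ℕ} {emin : ℤ} {fl : ℚ → ℚ}

/-! ## The witness -/

/-- `N_t(u) = 1 + (2-2u)(M_t(u) - 1)`: the attained round-toward-zero factor. -/
def treeN (u : ℚ) (t : SumTree) : ℚ := 1 + (2 - 2 * u) * (treeM u t - 1)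

/-- The round-toward-zero witness: the spine leaf is `S`; the light child at a spine node is the
round-to-nearest witness `wit` of `OptTreeWitness.lean` at scale `(2-2u)·S`, exponent `1`. -/
def witRZ (u S : ℚ) : SumTree → SumTree
  | .leaf _ => .leaf S
  | .node a b =>
      if treeM u b ≤ treeM u a then .node (witRZ u S a) (wit u ((2 - 2 * u) * S) b 1)
      else .node (wit u ((2 - 2 * u) * S) a 1) (witRZ u S b)

/-- `wit` has the shape of `t`: the same tree polynomial at EVERY parameter. -/
theorem treeM_wit_any (u' u s : ℚ) : ∀ (t : SumTree) (k : ℕ), treeM u' (wit u s t k) = treeM u' t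
  | .leaf x, k => by simp [wit]
  | .node a b, k => by
      by_cases h : treeM u b ≤ treeM u a
      · simp only [wit, if_pos h, treeM_node, treeM_wit_any u' u s a, treeM_wit_any u' u s b]
      · simp only [wit, if_neg h, treeM_node, treeM_wit_any u' u s a, treeM_wit_any u' u s b]

/-- `witRZ` has the shape of `t`: the same tree polynomial at every parameter. -/
theorem treeM_witRZ (u' u S : ℚ) : ∀ t : SumTree, treeM u' (witRZ u S t) = treeM u' t
  | .leaf x => by simp [witRZ]
  | .node a b => by
      by_cases h : treeM u b ≤ treeM u a
      · simp only [witRZ, if_pos h, treeM_node, treeM_witRZ u' u S a, treeM_wit_any]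
      · simp only [witRZ, if_neg h, treeM_node, treeM_witRZ u' u S b, treeM_wit_any]

/-- `witRZ` has the height of `t`. -/
theorem height_witRZ (u S : ℚ) : ∀ t : SumTree, height (witRZ u S t) = height t
  | .leaf x => by simp [witRZ]
  | .node a b => by
      by_cases h : treeM u b ≤ treeM u a
      · simp only [witRZ, if_pos h, height_node, height_witRZ u S a, height_wit]
      · simp only [witRZ, if_neg h, height_node, height_witRZ u S b, height_wit]

/-- Exact sum of the witness: `S·N_t(u)`. -/
theorem exact_witRZ (u S : ℚ) : ∀ t : SumTree, exact (witRZ u S t) = S * treeN u t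
  | .leaf x => by simp [witRZ, exact, treeN]
  | .node a b => by
      by_cases h : treeM u b ≤ treeM u a
      · simp only [witRZ, if_pos h, exact, exact_witRZ u S a, exact_wit, treeN, treeM_node,
          max_eq_left h, min_eq_right h]
        ring
      · have h' : treeM u a ≤ treeM u b := le_of_lt (not_le.mp h)
        simp only [witRZ, if_neg h, exact, exact_witRZ u S b, exact_wit, treeN, treeM_node,
          max_eq_right h', min_eq_left h']
        ring

/-- Every leaf of the witness is the spine value `S` or a light value `(2-2u)·S·u^j`,
`1 ≤ j ≤ height t`. -/
theorem mem_leaves_witRZ (u S : ℚ) : ∀ t : SumTree, ∀ x ∈ leaves (witRZ u S t),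
    x = S ∨ ∃ j : ℕ, 1 ≤ j ∧ j ≤ height t ∧ x = (2 - 2 * u) * S * u ^ j
  | .leaf y => by
      intro x hx
      simp [witRZ, leaves] at hx
      exact Or.inl hx
  | .node a b => by
      intro x hx
      have hma := le_max_left (height a) (height b)
      have hmb := le_max_right (height a) (height b)
      by_cases h : treeM u b ≤ treeM u a
      · simp only [witRZ, if_pos h, leaves, List.mem_append] at hx
        rcases hx with hx | hx
        · rcases mem_leaves_witRZ u S a x hx with hx | ⟨j, hj1, hj2, rfl⟩
          · exact Or.inl hx
          · exact Or.inr ⟨j, hj1, by simp only [height_node]; omega, rfl⟩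
        · obtain ⟨j, hj1, hj2, rfl⟩ := mem_leaves_wit u _ b 1 x hx
          exact Or.inr ⟨j, hj1, by simp only [height_node]; omega, rfl⟩
      · simp only [witRZ, if_neg h, leaves, List.mem_append] at hx
        rcases hx with hx | hx
        · obtain ⟨j, hj1, hj2, rfl⟩ := mem_leaves_wit u _ a 1 x hx
          exact Or.inr ⟨j, hj1, by simp only [height_node]; omega, rfl⟩
        · rcases mem_leaves_witRZ u S b x hx with hx | ⟨j, hj1, hj2, rfl⟩
          · exact Or.inl hx
          · exact Or.inr ⟨j, hj1, by simp only [height_node]; omega, rfl⟩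

/-- Evaluation of the witness when every addition is a full absorption: the computed root is the
spine value `S`. -/
theorem eval_witRZ (u S : ℚ) {fl : ℚ → ℚ} {N : ℕ}
    (hS : fl (S + (2 - 2 * u) * S * u ^ 1) = S)
    (hT : ∀ j : ℕ, j < N →
      fl ((2 - 2 * u) * S * u ^ j + (2 - 2 * u) * S * u ^ (j + 1)) = (2 - 2 * u) * S * u ^ j) :
    ∀ t : SumTree, height t ≤ N → eval fl (witRZ u S t) = S
  | .leaf x, _ => by simp [witRZ, eval]
  | .node a b, hk => by
      have hma := le_max_left (height a) (height b)
      have hmb := le_max_right (height a) (height b)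
      simp only [height_node] at hk
      by_cases h : treeM u b ≤ treeM u a
      · simp only [witRZ, if_pos h, eval, eval_witRZ u S hS hT a (by omega),
          eval_wit u _ hT b 1 (by omega)]
        exact hS
      · simp only [witRZ, if_neg h, eval, eval_witRZ u S hS hT b (by omega),
          eval_wit u _ hT a 1 (by omega)]
        rw [add_comm]; exact hS

/-! ## The absorptions hold under every round-down map -/

/-- `(2-2u)·2^e = (2^p - 1)·2^(e+1-p)`. -/
theorem two_sub_two_u_mul_zpow (p : ℕ) (e : ℤ) :
    (2 - 2 * unitRoundoff p) * (2 : ℚ) ^ e = ((2 ^ p - 1 : ℤ) : ℚ) * (2 : ℚ) ^ (e + 1 - p) := by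
  have h2 : (2 : ℚ) ≠ 0 := by norm_num
  have hP : (2 : ℚ) ^ (e + 1 - p) * (2 : ℚ) ^ p = (2 : ℚ) ^ (e + 1) := by
    rw [← zpow_natCast, ← zpow_add₀ h2]; congr 1; ring
  have hP0 : (0 : ℚ) < (2 : ℚ) ^ p := by positivity
  unfold unitRoundoff
  rw [zpow_add_one₀ h2] at hP
  push_cast
  field_simp
  nlinarith [hP]

/-- The light values are floats: `(2-2u)·2^E·u^j = (2^p-1)·2^(E+1-p-pj) ∈ F` when the exponent is
at least `emin`. -/
theorem isFloat_light (E : ℤ) (j : ℕ) (hE : emin + p + p * j ≤ E + 1) :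
    IsFloat p emin ((2 - 2 * unitRoundoff p) * (2 : ℚ) ^ E * unitRoundoff p ^ j) := by
  rw [mul_assoc, two_zpow_mul_u_pow, two_sub_two_u_mul_zpow]
  refine isFloat_of_int_mul _ _ ?_ (by push_cast; omega)
  have h1 : (1 : ℤ) ≤ 2 ^ p := by exact_mod_cast Nat.one_le_two_pow
  rw [abs_of_nonneg (by omega)]; omega

/-- SPINE ABSORPTION: `fl(2^E + (2-2u)·2^E·u) = 2^E` under round-down (`E + 1 ≥ emin + p`): the sum
lies strictly below the successor `2^E + 2^(E+1-p)` of `2^E`. -/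
theorem roundDown_absorb_spine (hp : 1 ≤ p) (hfl : IsRoundDownNonneg p emin fl) {E : ℤ}
    (hE : emin + p ≤ E + 1) :
    fl ((2 : ℚ) ^ E + (2 - 2 * unitRoundoff p) * (2 : ℚ) ^ E * unitRoundoff p ^ 1) = (2 : ℚ) ^ E := by
  have h2 : (2 : ℚ) ≠ 0 := by norm_num
  set x := (2 - 2 * unitRoundoff p) * (2 : ℚ) ^ E * unitRoundoff p ^ 1 with hx
  have hu0 := unitRoundoff_pos p
  have hu1 := unitRoundoff_le_one p
  have hx0 : 0 ≤ x := by
    rw [hx]; have : 0 ≤ 2 - 2 * unitRoundoff p := by linarith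
    exact mul_nonneg (mul_nonneg this (zpow_pos (by norm_num) _).le) (pow_nonneg hu0.le _)
  have hSF : IsFloat p emin ((2 : ℚ) ^ E) := isFloat_zpow hp hE
  have hS0 : (0 : ℚ) < (2 : ℚ) ^ E := zpow_pos (by norm_num) _
  refine le_antisymm ?_ (hfl.le_fl _ (by positivity) _ hSF (by linarith))
  -- fl(2^E + x) < 2^E + 2^(E+1-p) = (2^(p-1) + 1)·2^(E+1-p), hence ≤ 2^(p-1)·2^(E+1-p) = 2^E
  have hulp : (2 : ℚ) ^ E = ((2 ^ (p - 1) : ℤ) : ℚ) * (2 : ℚ) ^ (E + 1 - p) := by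
    have : ((2 ^ (p - 1) : ℤ) : ℚ) = (2 : ℚ) ^ (((p - 1 : ℕ) : ℤ)) := by
      rw [zpow_natCast]; push_cast; ring
    rw [this, ← zpow_add₀ h2]; congr 1; omega
  have hxlt : x < (2 : ℚ) ^ (E + 1 - p) := by
    have hc : (2 : ℚ) ^ (E + 1 - p) = 2 * ((2 : ℚ) ^ E * unitRoundoff p) := by
      unfold unitRoundoff
      rw [zpow_sub₀ h2, zpow_add_one₀ h2, zpow_natCast]; ring
    rw [hx, hc, pow_one]
    nlinarith [mul_pos hS0 hu0]
  have hlt : fl ((2 : ℚ) ^ E + x) < (((2 ^ (p - 1) : ℤ) : ℚ) + 1) * (2 : ℚ) ^ (E + 1 - p) := by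
    have := hfl.fl_le ((2 : ℚ) ^ E + x) (by positivity)
    rw [add_mul, one_mul, ← hulp]; linarith
  have := float_le_of_lt_succ hp (hfl.isFloat _) le_rfl hlt
  rwa [← hulp] at this

/-- T7(a) IS SHARP: for `a = 2^E`, `b = v·2^E = (2-2u)·2^E·u` (both floats when
`E + 1 ≥ emin + 2p`) the truncated sum is `2^E`: the loss is exactly `v·fl(a+b)`. -/
theorem truncation_bound_attained (hp : 1 ≤ p) (hfl : IsRoundDownNonneg p emin fl) {E : ℤ}
    (hE : emin + p + p ≤ E + 1) :
    IsFloat p emin ((2 - 2 * unitRoundoff p) * (2 : ℚ) ^ E * unitRoundoff p ^ 1) ∧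
    (2 : ℚ) ^ E + (2 - 2 * unitRoundoff p) * (2 : ℚ) ^ E * unitRoundoff p ^ 1
      = (1 + rzUnit p) * fl ((2 : ℚ) ^ E + (2 - 2 * unitRoundoff p) * (2 : ℚ) ^ E * unitRoundoff p ^ 1) := by
  refine ⟨by simpa using isFloat_light (emin := emin) E 1 (by simpa using hE), ?_⟩
  rw [roundDown_absorb_spine hp hfl (by omega), rzUnit]
  ring

/-- LIGHT ABSORPTION: with `s = (2-2u)·2^E`, `fl(s·u^j + s·u^(j+1)) = s·u^j` under round-down
whenever `s·u^j = (2^p-1)·2^G ∈ F`: the sum is strictly below `2^p·2^G`, the successor of `s·u^j`. -/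
theorem roundDown_absorb_light (hp : 1 ≤ p) (hfl : IsRoundDownNonneg p emin fl) (E : ℤ) (j : ℕ)
    (hE : emin + p + p * j ≤ E + 1) :
    fl ((2 - 2 * unitRoundoff p) * (2 : ℚ) ^ E * unitRoundoff p ^ j
        + (2 - 2 * unitRoundoff p) * (2 : ℚ) ^ E * unitRoundoff p ^ (j + 1))
      = (2 - 2 * unitRoundoff p) * (2 : ℚ) ^ E * unitRoundoff p ^ j := by
  have h2 : (2 : ℚ) ≠ 0 := by norm_num
  have hu0 := unitRoundoff_pos p
  have hu1 := unitRoundoff_le_one p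
  set y := (2 - 2 * unitRoundoff p) * (2 : ℚ) ^ E * unitRoundoff p ^ j with hy
  have hyF : IsFloat p emin y := isFloat_light E j hE
  have h22 : 0 ≤ 2 - 2 * unitRoundoff p := by linarith
  have hy0 : 0 ≤ y := by
    rw [hy]; exact mul_nonneg (mul_nonneg h22 (zpow_pos (by norm_num) _).le) (pow_nonneg hu0.le _)
  have hsucc : (2 - 2 * unitRoundoff p) * (2 : ℚ) ^ E * unitRoundoff p ^ (j + 1) = y * unitRoundoff p := by
    rw [hy, pow_succ]; ring
  rw [hsucc]
  have hyu0 : 0 ≤ y * unitRoundoff p := by positivity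
  refine le_antisymm ?_ (hfl.le_fl _ (by positivity) _ hyF (by linarith))
  -- y = (2^p - 1)·2^G with G = E - p j + 1 - p; y + y u < 2^p·2^G = ((2^p-1) + 1)·2^G
  have hyG : y = ((2 ^ p - 1 : ℤ) : ℚ) * (2 : ℚ) ^ (E - ((p * j : ℕ) : ℤ) + 1 - p) := by
    rw [hy, mul_assoc, two_zpow_mul_u_pow, two_sub_two_u_mul_zpow]
  set G : ℤ := E - ((p * j : ℕ) : ℤ) + 1 - p with hG
  have hG0 : (0 : ℚ) < (2 : ℚ) ^ G := zpow_pos (by norm_num) _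
  have hM : (2 : ℤ) ^ (p - 1) ≤ 2 ^ p - 1 := by
    have : (2 : ℤ) ^ p = 2 * 2 ^ (p - 1) := by
      rw [← pow_succ']; congr 1; omega
    have h1 : (1 : ℤ) ≤ 2 ^ (p - 1) := by exact_mod_cast Nat.one_le_two_pow
    omega
  have hlt : fl (y + y * unitRoundoff p) < (((2 ^ p - 1 : ℤ) : ℚ) + 1) * (2 : ℚ) ^ G := by
    have h1 := hfl.fl_le (y + y * unitRoundoff p) (by positivity)
    have h2' : y + y * unitRoundoff p < (((2 ^ p - 1 : ℤ) : ℚ) + 1) * (2 : ℚ) ^ G := by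
      rw [hyG]; push_cast
      have hP : (0 : ℚ) < (2 : ℚ) ^ p := by positivity
      have hu : unitRoundoff p * (2 : ℚ) ^ p = 1 := by
        unfold unitRoundoff; field_simp
      nlinarith [mul_pos hG0 hu0, mul_pos hG0 hP]
    linarith
  have := float_le_of_lt_succ hp (hfl.isFloat _) hM hlt
  rwa [← hyG] at this

/-! ## T7(c): the lower bound `1 - 1/N_t` is attained for every tree -/

/-- `1 ≤ N_t(u)` for `0 ≤ u ≤ 1`. -/
theorem one_le_treeN {u : ℚ} (hu0 : 0 ≤ u) (hu1 : u ≤ 1) (t : SumTree) : 1 ≤ treeN u t := by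
  unfold treeN
  have := one_le_treeM hu0 t
  nlinarith

/-- **T7(c)**: for every summation tree `t` and every round-down map, the witness `witRZ` at
`S = 2^(emin + p(height t + 1))` is an input of nonnegative floats of the same shape whose exact sum
`S·N_t` is computed as `S`: relative under-estimation EXACTLY `1 - 1/N_t(u)`. -/
theorem rz_witness_attains (hp : 1 ≤ p) (hfl : IsRoundDownNonneg p emin fl) (t : SumTree) :
    let u := unitRoundoff p
    let S := (2 : ℚ) ^ (emin + p * (height t + 1 : ℕ))
    (∀ x ∈ leaves (witRZ u S t), IsFloat p emin x ∧ 0 ≤ x) ∧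
      exact (witRZ u S t) = S * treeN u t ∧ eval fl (witRZ u S t) = S ∧
      exact (witRZ u S t) - eval fl (witRZ u S t) = (1 - 1 / treeN u t) * exact (witRZ u S t) := by
  intro u S
  have hu0 := unitRoundoff_pos p
  have hu1 := unitRoundoff_le_one p
  have hS0 : 0 < S := zpow_pos (by norm_num) _
  have hE : emin + p ≤ emin + p * (height t + 1 : ℕ) + 1 := by push_cast; nlinarith
  have hleaves : ∀ x ∈ leaves (witRZ u S t), IsFloat p emin x ∧ 0 ≤ x := by
    intro x hx
    rcases mem_leaves_witRZ u S t x hx with rfl | ⟨j, hj1, hj2, rfl⟩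
    · exact ⟨isFloat_zpow hp hE, hS0.le⟩
    · refine ⟨isFloat_light _ j ?_, ?_⟩
      · push_cast
        have : (p : ℤ) * j ≤ p * height t := by exact_mod_cast Nat.mul_le_mul_left p hj2
        nlinarith
      · have : 0 ≤ 2 - 2 * u := by linarith
        exact mul_nonneg (mul_nonneg this (zpow_pos (by norm_num) _).le) (pow_nonneg hu0.le _)
  have hexact := exact_witRZ u S t
  have heval : eval fl (witRZ u S t) = S := by
    refine eval_witRZ u S (N := height t) (roundDown_absorb_spine hp hfl hE) ?_ t le_rfl
    intro j hj
    refine roundDown_absorb_light hp hfl _ j ?_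
    push_cast
    have : (p : ℤ) * j + p ≤ p * height t := by
      have := Nat.mul_le_mul_left p (Nat.succ_le_of_lt hj)
      push_cast [Nat.succ_eq_add_one, mul_add] at this ⊢; linarith
    nlinarith
  refine ⟨hleaves, hexact, heval, ?_⟩
  rw [hexact, heval]
  have hN : 1 ≤ treeN u t := one_le_treeN hu0.le hu1 t
  have hN0 : treeN u t ≠ 0 := ne_of_gt (lt_of_lt_of_le one_pos hN)
  field_simp

/-! ## T7(d): the sequential law; T7(e): pairwise minimises -/

/-- **T7(d)**: on the sequential tree the attained factor and the upper-bound factor coincide: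
`N_seq(u) = 1 + (n-1)·v = M_seq(v)`.  Hence `W_RZ(seq_n) = (n-1)v/(1+(n-1)v)` exactly. -/
theorem treeN_seqTree (p : ℕ) (n : ℕ) (hn : 1 ≤ n) :
    treeN (unitRoundoff p) (seqTree n) = treeM (rzUnit p) (seqTree n) := by
  rw [treeN, treeM_seqTree (unitRoundoff_nonneg p) n hn, treeM_seqTree (rzUnit_nonneg p) n hn,
    rzUnit]
  ring

/-- `N_t` is monotone in `M_t(u)`: pairwise summation (`pw n`, the minimiser of the tree polynomial,
Theorem P) minimises the attained factor `N_t` too. -/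
theorem treeN_pw_le (p : ℕ) (t : SumTree) :
    treeN (unitRoundoff p) (pw (leaves t).length) ≤ treeN (unitRoundoff p) t := by
  unfold treeN
  have h := treeM_pw_le_treeM (unitRoundoff_nonneg p) (unitRoundoff_le_one p) t
  have : 0 ≤ 2 - 2 * unitRoundoff p := by linarith [unitRoundoff_le_one p]
  nlinarith

/-- **T7(e)**: pairwise summation minimises the upper bound `1 - 1/M_t(v)` as well. -/
theorem treeM_rzUnit_pw_le (p : ℕ) (t : SumTree) :
    treeM (rzUnit p) (pw (leaves t).length) ≤ treeM (rzUnit p) t :=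
  treeM_pw_le_treeM (rzUnit_nonneg p) (rzUnit_le_one p) t

/-! ## Statement-style R4 proposition -/

/-- THEOREM T7 (CM-T, T-poly, round-toward-zero on nonnegative data).  For every precision `p ≥ 1`
and every `emin`: round-down maps exist; for every round-down map (i) every tree under-estimates by
at most `1 - 1/M_t(v)`, `v = 2u - 2u²`; (ii) every tree has a nonnegative floating-point input of the
same shape (same tree polynomial at `u` and at `v`) with positive sum under-estimated by exactly
`1 - 1/N_t(u)`; (iii) on sequential trees `N = M(v)`: the law `(n-1)v/(1+(n-1)v)` is exact;
(iv) pairwise summation minimises both factors. -/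
def R4_TreeLawRZ : Prop :=
  ∀ (p : ℕ) (emin : ℤ), 1 ≤ p →
    (∃ fl : ℚ → ℚ, IsRoundDownNonneg p emin fl) ∧
    ∀ fl : ℚ → ℚ, IsRoundDownNonneg p emin fl →
      (∀ t : SumTree, (∀ x ∈ leaves t, IsFloat p emin x ∧ 0 ≤ x) →
        exact t - eval fl t ≤ (1 - 1 / treeM (rzUnit p) t) * exact t) ∧
      (∀ t : SumTree, ∃ w : SumTree,
        treeM (unitRoundoff p) w = treeM (unitRoundoff p) t ∧ treeM (rzUnit p) w = treeM (rzUnit p) t ∧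
        (∀ x ∈ leaves w, IsFloat p emin x ∧ 0 ≤ x) ∧ 0 < exact w ∧
        exact w - eval fl w = (1 - 1 / treeN (unitRoundoff p) t) * exact w) ∧
      (∀ n : ℕ, 1 ≤ n → treeN (unitRoundoff p) (seqTree n) = treeM (rzUnit p) (seqTree n)) ∧
      (∀ t : SumTree, treeN (unitRoundoff p) (pw (leaves t).length) ≤ treeN (unitRoundoff p) t ∧
        treeM (rzUnit p) (pw (leaves t).length) ≤ treeM (rzUnit p) t)

/-- `R4_TreeLawRZ` holds. -/
theorem R4_TreeLawRZ_holds : R4_TreeLawRZ := by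
  intro p emin hp
  refine ⟨exists_roundDown p emin, fun fl hfl => ⟨?_, ?_, ?_, ?_⟩⟩
  · exact fun t ht => exact_sub_eval_le_roundDown hp hfl t ht
  · intro t
    obtain ⟨hl, hexact, heval, hatt⟩ := rz_witness_attains hp hfl t
    refine ⟨_, treeM_witRZ _ _ _ t, treeM_witRZ _ _ _ t, hl, ?_, hatt⟩
    rw [hexact]
    exact mul_pos (zpow_pos (by norm_num) _)
      (lt_of_lt_of_le one_pos (one_le_treeN (unitRoundoff_nonneg p) (unitRoundoff_le_one p) t))
  · exact fun n hn => treeN_seqTree p n hn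
  · exact fun t => ⟨treeN_pw_le p t, treeM_rzUnit_pw_le p t⟩

end Summit.Ventures.CertifiedArithmetic.LowPrec.Opt
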